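import Summits.HubbardSuperconductivity.HubbardSuperconductivity.Theorems.CooperPairDMottWalkCooperPairDMottPairTrialCeilingLocality
import Literature.MathematicalPhysics.QuantumLattice.PairChirality
import Literature.MathematicalPhysics.QuantumLattice.HubbardRingPerronFrobeniusProofs
import Literature.MathematicalPhysics.QuantumLattice.LTQOFrustrationFreeProofs

/-!
# Route `CooperPairDMottWalk`, crux `CooperPairDMott` (stmt-HubbardSuperconductivity-1177):
# the one-plaquette trial operator `|π⟩⟨σ|`: grading, commutator, norms

Support file for the stub `stub_pairTrialCeiling`. The trial operator of the pair ceiling is the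
rank-one operator `A = |π⟩⟨σ| = vecMulVec π (star σ)` of ONE plaquette (`σ` a ground state of the
4-electron `S^z = 0` sector, `π` one of the 2-electron sector), embedded into the torus by the tree's
second quantisation `jwEmbed (orbEmb f)` of the block embedding `f`. This file proves:

* grading: `|π⟩⟨σ|` has `(N↑, N↓)`-grade `(sector π) − (sector σ)` (`shifts_vecMulVec`), and the
  second quantisation of an order embedding of site sets PRESERVES every grade (`shifts_jwEmbed`:
  the spin-resolved particle numbers of a big configuration are those of its block part plus those of
  its environment, `card_upPart_eq`, `card_downPart_eq`);
* the exact commutator `[h, |π⟩⟨σ|] = (E_π − E_σ) |π⟩⟨σ|` for a Hermitian `h` with `hπ = E_π π`,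
  `hσ = E_σ σ` (`commutator_vecMulVec`);
* `(|π⟩⟨σ|)ᴴ |π⟩⟨σ| = |σ⟩⟨σ|` for unit `π`, `|σ⟩⟨σ|` is a Hermitian idempotent of trace one for unit
  `σ`, and consequently `‖e_* |π⟩⟨σ|‖ ≤ 1` in the `ℓ²` operator norm and
  `‖e_*|π⟩⟨σ| V‖² = Re⟨V, e_*|σ⟩⟨σ| V⟩`.

References: H. Tasaki (2020) §9.3 (sectors); O. Bratteli, D. W. Robinson II (1997) §5.2.2. All
statements are [folklore]; no definition is introduced.
-/

set_option linter.dupNamespace false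

noncomputable section

namespace Summit.HubbardSuperconductivity.HubbardSuperconductivity.Theorems.CooperPairDMottWalk

open Matrix Finset Literature.MathematicalPhysics.QuantumLattice Literature.MathematicalPhysics.QuantumLattice.JWEmbed
open scoped ComplexOrder Matrix.Norms.L2Operator

/-! ### Grading of rank-one operators -/

section RankOne

variable {Λ : Type*} [LinearOrder Λ] [Fintype Λ]

/-- `|π⟩⟨σ|` maps the sector of `σ` to the sector of `π`: grade `(p − p', q − q')`. Tasaki (2020) §9.3.
[folklore] -/
theorem shifts_vecMulVec {p q p' q' : ℕ} {π σ : Fock (Orb Λ)} (hπ : IsInSector p q π) (hσ : IsInSector p' q' σ) :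
    PairChirality.Shifts ((p : ℤ) - p') ((q : ℤ) - q') (vecMulVec π (star σ)) := by
  intro s t hst
  rw [vecMulVec_apply, Pi.star_apply] at hst
  have hs : (upPart s).card = p ∧ (downPart s).card = q := by
    by_contra h
    exact hst (by rw [hπ s h, zero_mul])
  have ht : (upPart t).card = p' ∧ (downPart t).card = q' := by
    by_contra h
    exact hst (by rw [hσ t h, star_zero, mul_zero])
  omega

end RankOne

section RankOneAlgebra

variable {n : Type*} [Fintype n]

/-- **The exact commutator of a rank-one operator between eigenvectors**: for Hermitian `h`,
`hπ = E_π π`, `hσ = E_σ σ`: `h |π⟩⟨σ| − |π⟩⟨σ| h = (E_π − E_σ) |π⟩⟨σ|`. [folklore] -/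
theorem commutator_vecMulVec {h : Matrix n n ℂ} (hh : h.IsHermitian)
    {π σ : n → ℂ} {Eπ Eσ : ℝ} (hπ : h *ᵥ π = (Eπ : ℂ) • π) (hσ : h *ᵥ σ = (Eσ : ℂ) • σ) :
    h * vecMulVec π (star σ) - vecMulVec π (star σ) * h = ((Eπ - Eσ : ℝ) : ℂ) • vecMulVec π (star σ) := by
  have hσ' : star σ ᵥ* h = (Eσ : ℂ) • star σ := by
    have := congrArg star hσ
    rw [star_mulVec, hh.eq, star_smul, Complex.star_def, Complex.conj_ofReal] at this
    exact this
  rw [mul_vecMulVec, vecMulVec_mul, hπ, hσ', smul_vecMulVec, vecMulVec_smul, ← sub_smul,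
    Complex.ofReal_sub]

/-- `(|π⟩⟨σ|)ᴴ |π⟩⟨σ| = |σ⟩⟨σ|` for unit `π`. [folklore] -/
theorem conjTranspose_vecMulVec_mul_self {π σ : n → ℂ} (hπ1 : star π ⬝ᵥ π = 1) :
    (vecMulVec π (star σ))ᴴ * vecMulVec π (star σ) = vecMulVec σ (star σ) := by
  rw [conjTranspose_vecMulVec, star_star, vecMulVec_mul_vecMulVec, hπ1, one_smul]

/-- `|σ⟩⟨σ|` is idempotent for unit `σ`. [folklore] -/
theorem vecMulVec_self_mul_self {σ : n → ℂ} (hσ1 : star σ ⬝ᵥ σ = 1) :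
    vecMulVec σ (star σ) * vecMulVec σ (star σ) = vecMulVec σ (star σ) := by
  rw [vecMulVec_mul_vecMulVec, hσ1, one_smul]

omit [Fintype n] in
/-- `|σ⟩⟨σ|` is Hermitian. [folklore] -/
theorem isHermitian_vecMulVec_self (σ : n → ℂ) : (vecMulVec σ (star σ)).IsHermitian := by
  rw [IsHermitian, conjTranspose_vecMulVec, star_star]

/-- `tr |σ⟩⟨σ| = 1` for unit `σ`. [folklore] -/
theorem trace_vecMulVec_self {σ : n → ℂ} (hσ1 : star σ ⬝ᵥ σ = 1) :
    (vecMulVec σ (star σ)).trace = 1 := by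
  rw [trace_vecMulVec, dotProduct_comm, hσ1]

/-- `|σ⟩⟨σ| v = ⟨σ, v⟩ σ`. [folklore] -/
theorem vecMulVec_self_mulVec (σ v : n → ℂ) : vecMulVec σ (star σ) *ᵥ v = (star σ ⬝ᵥ v) • σ := by
  rw [vecMulVec_mulVec, op_smul_eq_smul]

end RankOneAlgebra

/-! ### Second quantisation preserves the `(N↑, N↓)`-grading -/

section Grading

variable {Λ Λ' : Type*} [LinearOrder Λ] [Fintype Λ] [LinearOrder Λ'] [Fintype Λ'] (e : Λ ↪o Λ')

omit [Fintype Λ'] in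
/-- A nonzero entry of an embedded matrix has equal environments and a nonzero small entry.
[folklore] -/
theorem env_eq_of_embedFun_ne_zero {a : Matrix (Finset (Orb Λ)) (Finset (Orb Λ)) ℂ} {u' v' : Finset (Orb Λ')}
    (h : embedFun (orbEmb e) a u' v' ≠ 0) :
    env (orbEmb e) u' = env (orbEmb e) v' ∧ a (pre (orbEmb e) u') (pre (orbEmb e) v') ≠ 0 := by
  rw [embedFun_apply] at h
  by_cases henv : env (orbEmb e) u' = env (orbEmb e) v'
  · rw [if_pos henv] at h
    exact ⟨henv, left_ne_zero_of_mul h⟩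
  · rw [if_neg henv] at h
    exact absurd rfl h

omit [Fintype Λ'] in
/-- Sites outside the range carry orbitals outside the orbital range. [folklore] -/
theorem orb_mem_rangeF_iff (x' : Λ') (τ : Fin 2) : orb x' τ ∈ rangeF (orbEmb e) ↔ ∃ x, e x = x' := by
  rw [mem_rangeF]
  constructor
  · rintro ⟨i, hi⟩
    refine ⟨(ofLex i).1, ?_⟩
    have h := congrArg (fun j : Orb Λ' => (ofLex j).1) hi
    simpa [orbEmb] using h
  · rintro ⟨x, rfl⟩
    exact ⟨orb x τ, orbEmb_orb e x τ⟩

/-- **The up-spin count of a big configuration is that of its block part plus that of its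
environment.** [folklore] -/
theorem card_upPart_eq [DecidableEq Λ'] (u' : Finset (Orb Λ')) :
    (upPart u').card = (upPart (pre (orbEmb e) u')).card +
      (Finset.univ.filter fun x' : Λ' => (¬ ∃ x, e x = x') ∧ orb x' 0 ∈ env (orbEmb e) u').card := by
  classical
  rw [← Finset.card_filter_add_card_filter_not (p := fun x' : Λ' => ∃ x, e x = x') (s := upPart u')]
  congr 1
  · rw [← Finset.card_map e.toEmbedding]
    congr 1
    ext x'
    simp only [Finset.mem_filter, mem_upPart, Finset.mem_map, RelEmbedding.coe_toEmbedding, mem_pre,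
      orbEmb_orb]
    constructor
    · rintro ⟨hx', x, rfl⟩
      exact ⟨x, hx', rfl⟩
    · rintro ⟨x, hx, rfl⟩
      exact ⟨hx, x, rfl⟩
  · congr 1
    ext x'
    simp only [Finset.mem_filter, mem_upPart, Finset.mem_univ, true_and, mem_env, orb_mem_rangeF_iff]
    tauto

/-- **The down-spin count of a big configuration is that of its block part plus that of its
environment.** [folklore] -/
theorem card_downPart_eq [DecidableEq Λ'] (u' : Finset (Orb Λ')) :
    (downPart u').card = (downPart (pre (orbEmb e) u')).card +
      (Finset.univ.filter fun x' : Λ' => (¬ ∃ x, e x = x') ∧ orb x' 1 ∈ env (orbEmb e) u').card := by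
  classical
  rw [← Finset.card_filter_add_card_filter_not (p := fun x' : Λ' => ∃ x, e x = x') (s := downPart u')]
  congr 1
  · rw [← Finset.card_map e.toEmbedding]
    congr 1
    ext x'
    simp only [Finset.mem_filter, mem_downPart, Finset.mem_map, RelEmbedding.coe_toEmbedding, mem_pre,
      orbEmb_orb]
    constructor
    · rintro ⟨hx', x, rfl⟩
      exact ⟨x, hx', rfl⟩
    · rintro ⟨x, hx, rfl⟩
      exact ⟨hx, x, rfl⟩
  · congr 1
    ext x'
    simp only [Finset.mem_filter, mem_downPart, Finset.mem_univ, true_and, mem_env, orb_mem_rangeF_iff]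
    tauto

/-- **Second quantisation preserves the `(N↑, N↓)`-grade**: if `M` shifts `(N↑, N↓)` by `(a, b)` on
the small Fock space, so does `e_* M` on the big one (the environment is a spectator).
Tasaki (2020) §9.3; Bratteli–Robinson II §5.2.2. [folklore] -/
theorem shifts_jwEmbed {a b : ℤ} {M : Matrix (Finset (Orb Λ)) (Finset (Orb Λ)) ℂ}
    (hM : PairChirality.Shifts a b M) : PairChirality.Shifts a b (jwEmbed (orbEmb e) M) := by
  classical
  intro u' v' h
  rw [jwEmbed_apply] at h
  obtain ⟨henv, hne⟩ := env_eq_of_embedFun_ne_zero e h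
  have hsmall := hM _ _ hne
  rw [card_upPart_eq e u', card_upPart_eq e v', card_downPart_eq e u', card_downPart_eq e v', henv]
  push_cast
  omega

/-- An embedded sector-`(p,q) → (p−1, q−1)` operator maps the joint sector `(2m+2, 0)` of the big
space into `(2m, 0)`. [folklore] -/
theorem jwEmbed_mulVec_mem_szSector {M : Matrix (Finset (Orb Λ)) (Finset (Orb Λ)) ℂ}
    (hM : PairChirality.Shifts (-1) (-1) M) {m : ℕ} {ψ : Fock (Orb Λ')} (hψ : ψ ∈ szSector (Λ := Λ') (2 * (m + 1)) 0) :
    jwEmbed (orbEmb e) M *ᵥ ψ ∈ szSector (Λ := Λ') (2 * m) 0 := by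
  rw [mem_szSector_two_mul_zero_iff] at hψ ⊢
  intro s hs
  rw [mulVec, dotProduct]
  refine Finset.sum_eq_zero fun t _ => ?_
  by_cases hMt : jwEmbed (orbEmb e) M s t = 0
  · rw [hMt, zero_mul]
  · have h := shifts_jwEmbed e hM s t hMt
    by_cases ht : (upPart t).card = m + 1 ∧ (downPart t).card = m + 1
    · exfalso
      apply hs
      omega
    · rw [hψ t ht, mul_zero]

end Grading

/-! ### Norms -/

section Norms

variable {n : Type*} [Fintype n] [DecidableEq n]

variable {ι ι' : Type*} [LinearOrder ι] [Fintype ι] [LinearOrder ι'] [Fintype ι'] (e : ι ↪o ι')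

/-- `‖xᴴ x‖ ≤ 1 ⟹ ‖x‖ ≤ 1` in a C⋆-algebra of matrices. [folklore] -/
theorem norm_le_one_of_conjTranspose_mul_self_le {x : Matrix n n ℂ} (h : ‖xᴴ * x‖ ≤ 1) : ‖x‖ ≤ 1 := by
  have h2 := CStarRing.norm_star_mul_self (x := x)
  rw [star_eq_conjTranspose] at h2
  nlinarith [norm_nonneg x]

/-- **The embedded trial operator is a contraction**: `‖e_* |π⟩⟨σ|‖ ≤ 1` for unit `π, σ`. [folklore] -/
theorem norm_jwEmbed_vecMulVec_le_one {π σ : Finset ι → ℂ} (hπ1 : star π ⬝ᵥ π = 1) (hσ1 : star σ ⬝ᵥ σ = 1) :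
    ‖jwEmbed e (vecMulVec π (star σ))‖ ≤ 1 := by
  refine norm_le_one_of_conjTranspose_mul_self_le ?_
  rw [← jwEmbed_conjTranspose, ← map_mul, conjTranspose_vecMulVec, star_star, vecMulVec_mul_vecMulVec,
    hπ1, one_smul]
  refine norm_le_one_of_isHermitian_of_isIdempotentElem ?_ ?_
  · rw [IsHermitian, ← jwEmbed_conjTranspose, conjTranspose_vecMulVec, star_star]
  · rw [← map_mul, vecMulVec_mul_vecMulVec, hσ1, one_smul]

/-- **The norm of the trial vector is a local expectation**: for unit `π`,
`⟨e_*|π⟩⟨σ| V, e_*|π⟩⟨σ| V⟩ = ⟨V, e_*|σ⟩⟨σ| V⟩`. [folklore] -/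
theorem star_trial_dotProduct_trial {π σ : Finset ι → ℂ} (hπ1 : star π ⬝ᵥ π = 1) (V : Finset ι' → ℂ) :
    star (jwEmbed e (vecMulVec π (star σ)) *ᵥ V) ⬝ᵥ (jwEmbed e (vecMulVec π (star σ)) *ᵥ V) =
      star V ⬝ᵥ (jwEmbed e (vecMulVec σ (star σ)) *ᵥ V) := by
  rw [star_mulVec, ← dotProduct_mulVec, mulVec_mulVec, ← jwEmbed_conjTranspose, ← map_mul,
    conjTranspose_vecMulVec, star_star, vecMulVec_mul_vecMulVec, hπ1, one_smul]

end Norms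

/-! ### Registered form -/

/-- **Registered sub-goal `pairTrialCeiling_gradingTransport`** (closed form, as registered on the crux
item): second quantisation of an order embedding of site sets preserves the `(N↑, N↓)`-grade of an
operator. [folklore] -/
theorem pairTrialCeiling_gradingTransport : ∀ {Λ Λ' : Type} [LinearOrder Λ] [Fintype Λ] [LinearOrder Λ'] [Fintype Λ'] (e : Λ ↪o Λ') {a b : ℤ} {M : Matrix (Finset (Orb Λ)) (Finset (Orb Λ)) ℂ}, PairChirality.Shifts a b M → PairChirality.Shifts a b (jwEmbed (orbEmb e) M) :=
  fun e _ _ _ hM => shifts_jwEmbed e hM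

end Summit.HubbardSuperconductivity.HubbardSuperconductivity.Theorems.CooperPairDMottWalk

end
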